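import Literature.Analysis.Fourier.ChirpAliasKernelPrelim
import HarnessLib

/-!
# Alias kernels of a super-Nyquist chirp: uniform `C^l` control of the truncations

For a chirp phase `φ` (`ChirpPhase φ H L Cφ`) and a real weight `w` which is continuous on `ℝ`,
smooth on `(H, ∞)` and a uniform symbol of order `0` there (e.g. `w = 1/φ'` or `φ''/φ'²`), the
*truncated amplitudes* `a_T = ρ_H η_T w` (`truncAmp`; cut-offs of `ChirpCutoffs.lean`) are good
amplitudes, and the truncated alias kernels `K_T(k)(u) = ∫_{τ>H} a_T(τ) e^{i(uτ + 2πkφ(τ))} dτ`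
(`aliasKT`, `ChirpAliasKernelPrelim.lean`) satisfy, uniformly in the mode `k ≠ 0` and the
frequency `|u| ≤ c' < 2πL` (no stationary point):
* `exists_iteratedDeriv_aliasKT_truncAmp_sub_le`: `‖K_T^{(l)}(k)(u) − K_{T'}^{(l)}(k)(u)‖ ≤ C_l (min T T')^{-1/2}`
  (`l + 2` integrations by parts, `exists_tail_bound`);
* `exists_iteratedDeriv_aliasKT_truncAmp_le`: `‖K_T^{(l)}(k)(u)‖ ≤ C_l`.
We also record the Leibniz estimate for a smooth cut-off `χ` supported in `[-c', c']`
(`exists_iteratedDeriv_cutoff_mul_le`). These are the inputs of the `k`-summation in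
`ChirpAliasKernelLimit.lean`. Source: Stein, *Harmonic Analysis* (1993), VIII §1.2; all proved,
the only definition is the amplitude `truncAmp`.
-/

noncomputable section

open Set Filter MeasureTheory
open scoped Topology ContDiff Real

namespace Literature.Analysis.Fourier

open _root_.Complex (I exp)

/-! ## Truncated amplitudes -/

/-- The truncated, cut-off amplitude `a_T(τ) = ρ_H(τ) η_T(τ) w(τ)`. [folklore] -/
def truncAmp (H : ℝ) (w : ℝ → ℝ) (T τ : ℝ) : ℝ := rhoCut H τ * etaCut T τ * w τ

section Weight

variable {H : ℝ} {w : ℝ → ℝ}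

/-- `a_T` is continuous when `w` is. [folklore] -/
theorem continuous_truncAmp (hwc : Continuous w) (T : ℝ) : Continuous (truncAmp H w T) :=
  ((contDiff_rhoCut H).continuous.mul (contDiff_etaCut T).continuous).mul hwc

/-- `a_T = 0` below `H + 1/4`. [folklore] -/
theorem truncAmp_eq_zero_of_lt (T : ℝ) {τ : ℝ} (hτ : τ < H + 1 / 4) : truncAmp H w T τ = 0 := by
  simp [truncAmp, rhoCut_eq_zero hτ.le]

/-- `a_T = 0` above `2T` (`T > 0`). [folklore] -/
theorem truncAmp_eq_zero_of_gt {T : ℝ} (hT : 0 < T) {τ : ℝ} (hτ : 2 * T < τ) :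
    truncAmp H w T τ = 0 := by
  simp [truncAmp, etaCut_eq_zero hT hτ.le]

/-- `a_T` is smooth on `(H, ∞)` when `w` is. [folklore] -/
theorem contDiffOn_truncAmp (hws : ContDiffOn ℝ ∞ w (Ioi H)) (T : ℝ) :
    ContDiffOn ℝ ∞ (truncAmp H w T) (Ioi H) :=
  ((contDiff_rhoCut H).contDiffOn.mul (contDiff_etaCut T).contDiffOn).mul hws

/-- `a_T` is a good amplitude (`T > 0`). [folklore] -/
theorem goodAmp_truncAmp (hws : ContDiffOn ℝ ∞ w (Ioi H)) {T : ℝ} (hT : 0 < T) :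
    GoodAmp H (truncAmp H w T) :=
  ⟨contDiffOn_truncAmp hws T, fun _ hτ => truncAmp_eq_zero_of_lt T hτ, 2 * T,
    fun _ hτ => truncAmp_eq_zero_of_gt hT hτ⟩

/-- The truncated alias kernel is smooth in the frequency. [folklore] -/
theorem contDiff_aliasKT_truncAmp {φ : ℝ → ℝ} (hφ : Continuous φ) (hwc : Continuous w) {T : ℝ}
    (hT : 0 < T) (k : ℤ) : ContDiff ℝ ∞ (aliasKT φ H (truncAmp H w T) k) :=
  contDiff_aliasKT hφ (continuous_truncAmp hwc T) (fun _ hτ => truncAmp_eq_zero_of_lt T hτ)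
    (fun _ hτ => truncAmp_eq_zero_of_gt hT hτ) k

/-- The integrands `τ^l a_T e` are integrable on `(H, ∞)`. [folklore] -/
theorem integrableOn_pow_mul_truncAmp {φ : ℝ → ℝ} (hφ : Continuous φ) (hwc : Continuous w)
    {T : ℝ} (hT : 0 < T) (k : ℤ) (l : ℕ) (u : ℝ) :
    IntegrableOn (fun τ => ((τ ^ l * truncAmp H w T τ : ℝ) : ℂ) * chirpE φ k u τ) (Ioi H) :=
  integrableOn_Ioi_of_zero (R := 2 * T)
    ((Complex.continuous_ofReal.comp ((continuous_pow l).mul (continuous_truncAmp hwc T))).mul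
      (continuous_chirpE hφ k u)).continuousOn
    (fun τ hτ => by simp [truncAmp_eq_zero_of_lt T hτ])
    (fun τ hτ => by simp [truncAmp_eq_zero_of_gt hT hτ])

/-- Difference of two truncations, at the level of the `l`-th derivative:
`K_T^{(l)}(u) − K_{T'}^{(l)}(u) = i^l ∫ τ^l (a_T − a_{T'}) e`. [folklore] -/
theorem iteratedDeriv_aliasKT_truncAmp_sub {φ : ℝ → ℝ} (hφ : Continuous φ) (hwc : Continuous w)
    {T T' : ℝ} (hT : 0 < T) (hT' : 0 < T') (k : ℤ) (l : ℕ) (u : ℝ) :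
    iteratedDeriv l (aliasKT φ H (truncAmp H w T) k) u -
      iteratedDeriv l (aliasKT φ H (truncAmp H w T') k) u =
      I ^ l * ∫ τ in Ioi H, ((τ ^ l * (truncAmp H w T τ - truncAmp H w T' τ) : ℝ) : ℂ) *
        chirpE φ k u τ := by
  rw [iteratedDeriv_aliasKT_apply hφ (continuous_truncAmp hwc T)
      (fun _ hτ => truncAmp_eq_zero_of_lt T hτ) (fun _ hτ => truncAmp_eq_zero_of_gt hT hτ),
    iteratedDeriv_aliasKT_apply hφ (continuous_truncAmp hwc T')
      (fun _ hτ => truncAmp_eq_zero_of_lt T' hτ) (fun _ hτ => truncAmp_eq_zero_of_gt hT' hτ),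
    ← mul_sub, ← integral_sub (integrableOn_pow_mul_truncAmp hφ hwc hT k l u)
      (integrableOn_pow_mul_truncAmp hφ hwc hT' k l u)]
  congr 1
  refine integral_congr_ae (Eventually.of_forall fun τ => ?_)
  push_cast
  ring

end Weight

/-! ## Uniform bounds by non-stationary phase -/

section Bounds

variable {φ : ℝ → ℝ} {H L : ℝ} {Cφ : ℕ → ℝ} (hφ : ChirpPhase φ H L Cφ)
  {w : ℝ → ℝ} (hwc : Continuous w) (hws : ContDiffOn ℝ ∞ w (Ioi H))
  (hwb : ∀ R, SymBnd (univ : Set Unit) H 0 R (fun _ => w))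
  {c' : ℝ} (hc' : 0 ≤ c') (hcL : c' < 2 * π * L)

/-- The index set of the uniform family: modes `k ≠ 0`, frequencies `|u| ≤ c'`, truncation
heights `T, T' ≥ 1`. [folklore] -/
def cauchyIdx (c' : ℝ) : Set (ℤ × ℝ × ℝ × ℝ) :=
  {i | i.1 ≠ 0 ∧ |i.2.1| ≤ c' ∧ 1 ≤ i.2.2.1 ∧ 1 ≤ i.2.2.2}

include hφ hws hwb in
/-- The amplitudes `τ^l ρ_H (η_T − η_{T'}) w` form a smooth uniform symbol family of order `l`
of good amplitudes over `cauchyIdx c'`. [folklore] -/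
theorem symbFam_pow_mul_truncAmp_sub (l : ℕ) :
    SmoothFam (cauchyIdx c') H (fun i τ => τ ^ l * (truncAmp H w i.2.2.1 τ - truncAmp H w i.2.2.2 τ))
    ∧ (∀ R, SymBnd (cauchyIdx c') H l R
        (fun i τ => τ ^ l * (truncAmp H w i.2.2.1 τ - truncAmp H w i.2.2.2 τ)))
    ∧ ∀ i ∈ cauchyIdx c', GoodAmp H
        (fun τ => τ ^ l * (truncAmp H w i.2.2.1 τ - truncAmp H w i.2.2.2 τ)) := by
  have hH := hφ.one_le
  set S := cauchyIdx c' with hS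
  -- the factors as families
  have sρ : SmoothFam S H (fun (_ : ℤ × ℝ × ℝ × ℝ) τ => rhoCut H τ) := SmoothFam.rhoCut S H
  have sη : SmoothFam S H (fun (i : ℤ × ℝ × ℝ × ℝ) τ => etaCut i.2.2.1 τ) :=
    SmoothFam.etaCut S H _
  have sη' : SmoothFam S H (fun (i : ℤ × ℝ × ℝ × ℝ) τ => etaCut i.2.2.2 τ) :=
    SmoothFam.etaCut S H _
  have sw : SmoothFam S H (fun (_ : ℤ × ℝ × ℝ × ℝ) => w) := fun _ _ => hws
  have sd : SmoothFam S H (fun (i : ℤ × ℝ × ℝ × ℝ) τ => etaCut i.2.2.1 τ + -etaCut i.2.2.2 τ) :=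
    sη.add (by simpa using sη'.const_mul (fun _ => (-1 : ℝ)))
  have bρ : ∀ R, SymBnd S H 0 R (fun (_ : ℤ × ℝ × ℝ × ℝ) τ => rhoCut H τ) :=
    fun R => SymBnd.rhoCut S hH R
  have bη : ∀ R, SymBnd S H 0 R (fun (i : ℤ × ℝ × ℝ × ℝ) τ => etaCut i.2.2.1 τ) :=
    fun R => SymBnd.etaCut hH _ (fun i hi => hi.2.2.1) R
  have bη' : ∀ R, SymBnd S H 0 R (fun (i : ℤ × ℝ × ℝ × ℝ) τ => etaCut i.2.2.2 τ) :=
    fun R => SymBnd.etaCut hH _ (fun i hi => hi.2.2.2) R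
  have bw : ∀ R, SymBnd S H 0 R (fun (_ : ℤ × ℝ × ℝ × ℝ) => w) :=
    fun R => (hwb R).comp (fun _ => ()) (mapsTo_univ _ _)
  have bd : ∀ R, SymBnd S H 0 R
      (fun (i : ℤ × ℝ × ℝ × ℝ) τ => etaCut i.2.2.1 τ + -etaCut i.2.2.2 τ) :=
    fun R => SymBnd.add hH sη (by simpa using sη'.const_mul (fun _ => (-1 : ℝ))) (bη R) (bη' R).neg
  -- assemble `τ^l * (ρ * (d * w))`
  have s1 : SmoothFam S H (fun (i : ℤ × ℝ × ℝ × ℝ) τ =>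
      (etaCut i.2.2.1 τ + -etaCut i.2.2.2 τ) * w τ) := sd.mul sw
  have b1 : ∀ R, SymBnd S H (0 + 0) R (fun (i : ℤ × ℝ × ℝ × ℝ) τ =>
      (etaCut i.2.2.1 τ + -etaCut i.2.2.2 τ) * w τ) := fun R => SymBnd.mul hH sd sw (bd R) (bw R)
  have s2 : SmoothFam S H (fun (i : ℤ × ℝ × ℝ × ℝ) τ =>
      rhoCut H τ * ((etaCut i.2.2.1 τ + -etaCut i.2.2.2 τ) * w τ)) := sρ.mul s1
  have b2 : ∀ R, SymBnd S H (0 + (0 + 0)) R (fun (i : ℤ × ℝ × ℝ × ℝ) τ =>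
      rhoCut H τ * ((etaCut i.2.2.1 τ + -etaCut i.2.2.2 τ) * w τ)) :=
    fun R => SymBnd.mul hH sρ s1 (bρ R) (b1 R)
  have s3 : SmoothFam S H (fun (i : ℤ × ℝ × ℝ × ℝ) τ =>
      τ ^ l * (rhoCut H τ * ((etaCut i.2.2.1 τ + -etaCut i.2.2.2 τ) * w τ))) :=
    (SmoothFam.pow S H l).mul s2
  have b3 : ∀ R, SymBnd S H (l + (0 + (0 + 0))) R (fun (i : ℤ × ℝ × ℝ × ℝ) τ =>
      τ ^ l * (rhoCut H τ * ((etaCut i.2.2.1 τ + -etaCut i.2.2.2 τ) * w τ))) :=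
    fun R => SymBnd.mul hH (SmoothFam.pow S H l) s2 (SymBnd.pow S hH l R) (b2 R)
  have heq : ∀ (i : ℤ × ℝ × ℝ × ℝ) τ,
      τ ^ l * (rhoCut H τ * ((etaCut i.2.2.1 τ + -etaCut i.2.2.2 τ) * w τ)) =
      τ ^ l * (truncAmp H w i.2.2.1 τ - truncAmp H w i.2.2.2 τ) := fun i τ => by
    simp only [truncAmp]; ring
  refine ⟨s3.congr fun i _ τ _ => heq i τ, fun R => ((b3 R).congr fun i _ τ _ => heq i τ).of_eq
    (by ring), fun i hi => ?_⟩
  -- good amplitudes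
  have hT : 0 < i.2.2.1 := by linarith [hi.2.2.1]
  have hT' : 0 < i.2.2.2 := by linarith [hi.2.2.2]
  refine ⟨(s3 i hi).congr fun τ _ => (heq i τ).symm, fun τ hτ => ?_,
    2 * max i.2.2.1 i.2.2.2, fun τ hτ => ?_⟩
  · simp [truncAmp_eq_zero_of_lt _ hτ]
  · have h1 : 2 * i.2.2.1 < τ := lt_of_le_of_lt (by linarith [le_max_left i.2.2.1 i.2.2.2]) hτ
    have h2 : 2 * i.2.2.2 < τ := lt_of_le_of_lt (by linarith [le_max_right i.2.2.1 i.2.2.2]) hτ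
    simp [truncAmp_eq_zero_of_gt hT h1, truncAmp_eq_zero_of_gt hT' h2]

include hφ hwc hws hwb hc' hcL in
/-- **Uniform Cauchy estimate for the truncated alias kernels.** For every `l` there is `C_l`
with `‖K_T^{(l)}(k)(u) − K_{T'}^{(l)}(k)(u)‖ ≤ C_l (min T T')^{-1/2}` for all `k ≠ 0`, `|u| ≤ c'`,
`T, T' ≥ 1`. [folklore] -/
theorem exists_iteratedDeriv_aliasKT_truncAmp_sub_le (l : ℕ) :
    ∃ C, 0 ≤ C ∧ ∀ k : ℤ, k ≠ 0 → ∀ u : ℝ, |u| ≤ c' → ∀ T T' : ℝ, 1 ≤ T → 1 ≤ T' →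
      ‖iteratedDeriv l (aliasKT φ H (truncAmp H w T) k) u -
        iteratedDeriv l (aliasKT φ H (truncAmp H w T') k) u‖ ≤
        C * (min T T') ^ (-(1 / 2) : ℝ) := by
  have hH := hφ.one_le
  obtain ⟨hs, hb, hg⟩ := symbFam_pow_mul_truncAmp_sub hφ hws hwb (c' := c') l
  obtain ⟨C, hC, hCb⟩ := exists_tail_bound hφ (S := cauchyIdx c') (fun i => i.1) (fun i => i.2.1)
    hc' hcL (fun i hi => ⟨hi.1, hi.2.1⟩) hs hb hg
  refine ⟨C, hC, fun k hk u hu T T' hT hT' => ?_⟩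
  have hT0 : 0 < T := by linarith
  have hT0' : 0 < T' := by linarith
  set i : ℤ × ℝ × ℝ × ℝ := (k, u, T, T') with hi_def
  have hi : i ∈ cauchyIdx c' := ⟨hk, hu, hT, hT'⟩
  set T₀ := max H (min T T') with hT₀
  have hmin : 0 < min T T' := lt_min hT0 hT0'
  have hz : ∀ τ, τ < T₀ → τ ^ l * (truncAmp H w T τ - truncAmp H w T' τ) = 0 := by
    intro τ hτ
    rcases lt_max_iff.mp hτ with h | h
    · simp [truncAmp_eq_zero_of_lt _ (show τ < H + 1 / 4 by linarith)]
    · have h1 : τ ≤ T := (h.trans_le (min_le_left _ _)).le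
      have h2 : τ ≤ T' := (h.trans_le (min_le_right _ _)).le
      simp [truncAmp, etaCut_eq_one hT0 h1, etaCut_eq_one hT0' h2]
  have key := hCb i hi T₀ (le_max_left _ _) hz
  rw [iteratedDeriv_aliasKT_truncAmp_sub hφ.smooth.continuous hwc hT0 hT0' k l u, norm_mul,
    norm_pow, Complex.norm_I, one_pow, one_mul]
  refine key.trans (mul_le_mul_of_nonneg_left ?_ hC)
  exact Real.rpow_le_rpow_of_nonpos hmin (le_max_right _ _) (by norm_num)

include hφ hwc hws hwb hc' hcL in
/-- **Uniform bound for the truncated alias kernels**: `‖K_T^{(l)}(k)(u)‖ ≤ C_l` for all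
`k ≠ 0`, `|u| ≤ c'`, `T ≥ 1` (the Cauchy estimate plus the trivial bound at `T = 1`).
[folklore] -/
theorem exists_iteratedDeriv_aliasKT_truncAmp_le (l : ℕ) :
    ∃ C, 0 ≤ C ∧ ∀ k : ℤ, k ≠ 0 → ∀ u : ℝ, |u| ≤ c' → ∀ T : ℝ, 1 ≤ T →
      ‖iteratedDeriv l (aliasKT φ H (truncAmp H w T) k) u‖ ≤ C := by
  obtain ⟨C, hC, hCb⟩ := exists_iteratedDeriv_aliasKT_truncAmp_sub_le hφ hwc hws hwb hc' hcL l
  set B := ∫ τ in Ioi H, |τ ^ l * truncAmp H w 1 τ| with hB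
  have hB0 : 0 ≤ B := integral_nonneg fun τ => abs_nonneg _
  refine ⟨B + C, add_nonneg hB0 hC, fun k hk u hu T hT => ?_⟩
  have h1 : ‖iteratedDeriv l (aliasKT φ H (truncAmp H w 1) k) u‖ ≤ B := by
    rw [iteratedDeriv_aliasKT_apply hφ.smooth.continuous (continuous_truncAmp hwc 1)
      (fun _ hτ => truncAmp_eq_zero_of_lt 1 hτ) (fun _ hτ => truncAmp_eq_zero_of_gt one_pos hτ),
      norm_mul, norm_pow, Complex.norm_I, one_pow, one_mul]
    refine (norm_integral_le_integral_norm _).trans (le_of_eq ?_)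
    refine integral_congr_ae (Eventually.of_forall fun τ => ?_)
    simp only [norm_mul, norm_chirpE, mul_one, Complex.norm_real, Real.norm_eq_abs]
    rw [← abs_mul]
  have h2 := hCb k hk u hu T 1 hT le_rfl
  rw [min_eq_right hT, Real.one_rpow, mul_one] at h2
  calc ‖iteratedDeriv l (aliasKT φ H (truncAmp H w T) k) u‖
      ≤ ‖iteratedDeriv l (aliasKT φ H (truncAmp H w 1) k) u‖ +
        ‖iteratedDeriv l (aliasKT φ H (truncAmp H w T) k) u -
          iteratedDeriv l (aliasKT φ H (truncAmp H w 1) k) u‖ := norm_le_insert' _ _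
    _ ≤ B + C := add_le_add h1 h2

end Bounds

/-! ## Leibniz estimate for a compactly supported cut-off -/

/-- **Cut-off Leibniz estimate.** For a smooth `χ` supported in `[-c', c']` and every `l` there
is `M_l` such that: if `f` is smooth with `‖f^{(j)}(x)‖ ≤ ε` for `j ≤ l`, `|x| ≤ c'`, then
`‖(χ f)^{(l)}(x)‖ ≤ M_l ε` for ALL real `x`. [folklore] -/
theorem exists_iteratedDeriv_cutoff_mul_le {χ : ℝ → ℂ} (hχ : ContDiff ℝ ∞ χ) {c' : ℝ}
    (hχs : tsupport χ ⊆ Icc (-c') c') (l : ℕ) :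
    ∃ M, 0 ≤ M ∧ ∀ f : ℝ → ℂ, ContDiff ℝ ∞ f → ∀ ε : ℝ, 0 ≤ ε →
      (∀ j ≤ l, ∀ x : ℝ, |x| ≤ c' → ‖iteratedDeriv j f x‖ ≤ ε) →
      ∀ x : ℝ, ‖iteratedDeriv l (fun y => χ y * f y) x‖ ≤ M * ε := by
  -- bounds for the derivatives of `χ` on the compact interval
  have hB : ∀ j, ∃ B, 0 ≤ B ∧ ∀ x ∈ Icc (-c') c', ‖iteratedDeriv j χ x‖ ≤ B := by
    intro j
    have hc : Continuous (iteratedDeriv j χ) := hχ.continuous_iteratedDeriv j (mod_cast le_top)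
    obtain ⟨B, hB⟩ := isCompact_Icc.exists_bound_of_continuousOn (hc.continuousOn (s := Icc (-c') c'))
    exact ⟨max B 0, le_max_right _ _, fun x hx => (hB x hx).trans (le_max_left _ _)⟩
  choose B hB0 hB using hB
  refine ⟨∑ j ∈ Finset.range (l + 1), (l.choose j : ℝ) * B j, Finset.sum_nonneg fun j _ =>
    mul_nonneg (Nat.cast_nonneg _) (hB0 j), fun f hf ε hε hfε x => ?_⟩
  by_cases hx : x ∈ Icc (-c') c'
  · have hxa : |x| ≤ c' := abs_le.mpr hx
    have hcχ : ContDiffAt ℝ l χ x := (hχ.of_le (mod_cast le_top)).contDiffAt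
    have hcf : ContDiffAt ℝ l f x := (hf.of_le (mod_cast le_top)).contDiffAt
    rw [iteratedDeriv_fun_mul hcχ hcf]
    calc ‖∑ j ∈ Finset.range (l + 1),
            (l.choose j : ℂ) * iteratedDeriv j χ x * iteratedDeriv (l - j) f x‖
        ≤ ∑ j ∈ Finset.range (l + 1),
            ‖(l.choose j : ℂ) * iteratedDeriv j χ x * iteratedDeriv (l - j) f x‖ :=
          norm_sum_le _ _
      _ ≤ ∑ j ∈ Finset.range (l + 1), (l.choose j : ℝ) * B j * ε := by
          refine Finset.sum_le_sum fun j hj => ?_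
          have hjl : l - j ≤ l := Nat.sub_le l j
          rw [norm_mul, norm_mul, Complex.norm_natCast]
          exact mul_le_mul (mul_le_mul_of_nonneg_left (hB j x hx) (Nat.cast_nonneg _))
            (hfε (l - j) hjl x hxa) (norm_nonneg _) (mul_nonneg (Nat.cast_nonneg _) (hB0 j))
      _ = (∑ j ∈ Finset.range (l + 1), (l.choose j : ℝ) * B j) * ε := by
          rw [Finset.sum_mul]
  · -- outside the support everything vanishes
    have hx' : x ∉ tsupport χ := fun h => hx (hχs h)
    have hx'' : χ =ᶠ[𝓝 x] 0 := notMem_tsupport_iff_eventuallyEq.mp hx'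
    have h0 : (fun y => χ y * f y) =ᶠ[𝓝 x] fun _ => 0 := by
      filter_upwards [hx''] with y hy
      rw [hy, Pi.zero_apply, zero_mul]
    rw [h0.iteratedDeriv_eq, iteratedDeriv_const]
    have : 0 ≤ (∑ j ∈ Finset.range (l + 1), (l.choose j : ℝ) * B j) * ε :=
      mul_nonneg (Finset.sum_nonneg fun j _ => mul_nonneg (Nat.cast_nonneg _) (hB0 j)) hε
    rcases l with _ | l <;> simpa using this

end Literature.Analysis.Fourier
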